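import Summits.CriticalPhenomena.SAWScalingLimit.Theorems.SAWLeftRightFKGFKGToTraversalBoundDomainMarkov
import HarnessLib

/-!
# Slit necklace, piece 5: the weight half of the disintegrations (T) and (B)

Crux `SAWLeftRightFKG.FKGToTraversalBound` (stmt-CriticalPhenomena-1878), line
`gates-by-bubble-doors-by-fkg`, registered helpers `necklace_tailIdentity` and `necklace_beadIdentity` of the
stub `stub_necklace` (`SAWCollarBound → GermExcursionMean → DeepShellTight`).

Exact identities between critical SAW weights `SAW.weight Ω δ a b = Σ_γ x_c^{|γ|} δ_γ` on the chords of
`Ω_δ = discreteDomainGraph Ω δ`, DEF-FREE over tree names, in the form the necklace consumes together with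
`necklace_hungPresentation` (whose conclusion is exactly the graph hypothesis below, with `Keep(b, K)`):

* (T) `necklace_tailIdentity` — TAIL given the NECKLACE: for a self-avoiding prefix `ω : a → t` and a set
  `K ∌ t` of sites containing `ω ∖ {t}` (in the necklace: the slit and the necklace minus the last slit
  vertex `t = γ(L)`), `w_{Ω,a,b}(γ = ω · q, q avoids K, P(q)) = x_c^{|ω|} · w_{Ω',t,b}(P)` for ANY `Ω'`
  whose graph is `Ω_δ` restricted to `Keep(b, K)` = the sites joined to `b` off `K`;
* (B) `necklace_beadIdentity` — BEAD given EVERYTHING ELSE: for self-avoiding `ω₁ : a → u`, `ω₂ : u' → b`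
  meeting at most in `u = u'`, and `K ∌ u, u'` containing `ω₁ ∖ {u}` and `ω₂ ∖ {u'}`,
  `w_{Ω,a,b}(γ = ω₁ · β · ω₂, β avoids K, P(β)) = x_c^{|ω₁| + |ω₂|} · w_{Ω'',u,u'}(P)` for ANY `Ω''` whose
  graph is `Ω_δ` restricted to `Keep(u', K)`.

Ingredients: the landed `weight_prefix`, `weight_restrict`, the cut lemma `forall_support_notMem_iff_of_cut`
(p85820), and the mirror image `weight_suffix` of `weight_prefix` proved here (`β ↦ β · ω₂`).  Dividing by
the total masses gives the conditional LAWS; with `necklace_hungPresentation` the right-hand sides are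
critical chord weights of r2 carriers, to which `SAWCollarBound` speaks.  Only theorems; no named fact;
axioms are the standard three.
-/

noncomputable section

open MeasureTheory Set
open scoped ENNReal
open Literature.Probability.LatticeModels
open Literature.Probability.RandomPlanarGeometry
open Literature.Probability.RandomPlanarGeometry.SAW
open Summit.CriticalPhenomena.SAWScalingLimit.Theorems.FKGToTraversalBound.ExcursionDomination
  (domainSAW_ext_walk weight_eq_tsum_preimage weight_eq_tsum_indicator isPath_append_iff append_left_cancel
    weight_prefix weight_restrict forall_support_notMem_iff_of_cut)

namespace Summit.CriticalPhenomena.SAWScalingLimit.Theorems.FKGToTraversalBound.GatesByBubbleDoorsByFKG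

variable {Ω Ω' : Set ℂ} {δ : ℝ} {a b u u' t : Site 2}

/-! ### Right cancellation and the suffix identity -/

/-- Right cancellation of `Walk.append`. [folklore] -/
theorem append_right_cancel {V : Type*} {G : SimpleGraph V} {x y z : V} {p₁ p₂ : G.Walk x y}
    (q : G.Walk y z) (h : p₁.append q = p₂.append q) : p₁ = p₂ := by
  apply SimpleGraph.Walk.ext_support
  have hs := congrArg SimpleGraph.Walk.support h
  rw [SimpleGraph.Walk.support_append, SimpleGraph.Walk.support_append] at hs
  exact List.append_cancel_right hs

/-- **Suffix identity** (mirror image of `weight_prefix`).  For a self-avoiding suffix `ω₂ : u' → b` and any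
event `P` read on the vertex sequence of the earlier part, the `x_c`-weight of the chords `u → b` of the form
`β · ω₂` with `P(β)` is `x_c^{|ω₂|}` times the `x_c`-weight of the chords `β : u → u'` meeting `ω₂` only at
`u'` with `P(β)`. [folklore] -/
theorem weight_suffix (ω₂ : (discreteDomainGraph Ω δ).Walk u' b) (hω₂ : ω₂.IsPath)
    (P : List (Site 2) → Prop) :
    weight Ω δ u b {γ | ∃ β : (discreteDomainGraph Ω δ).Walk u u',
        γ.walk = β.append ω₂ ∧ P β.support} =
      ENNReal.ofReal (criticalFugacity ^ ω₂.length) *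
        weight Ω δ u u' {β' | (∀ v ∈ ω₂.support, v ∈ β'.walk.support → v = u') ∧
          P β'.walk.support} := by
  classical
  set C : Set (DomainSAW Ω δ u u') := {β' | ∀ v ∈ ω₂.support, v ∈ β'.walk.support → v = u'} with hC
  let Φ : C → DomainSAW Ω δ u b := fun β' =>
    ⟨β'.1.walk.append ω₂, (isPath_append_iff β'.1.walk ω₂).2 ⟨β'.1.isPath, hω₂, β'.2⟩⟩
  have hwalk : ∀ β' : C, (Φ β').walk = β'.1.walk.append ω₂ := fun _ => rfl
  have hlen : ∀ β' : C, (Φ β').length = β'.1.length + ω₂.length :=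
    fun β' => SimpleGraph.Walk.length_append _ _
  have hΦ : Function.Injective Φ := by
    rintro ⟨β₁, h₁⟩ ⟨β₂, h₂⟩ h
    have h' : β₁.walk.append ω₂ = β₂.walk.append ω₂ := by
      rw [← hwalk ⟨β₁, h₁⟩, ← hwalk ⟨β₂, h₂⟩, h]
    exact Subtype.ext (domainSAW_ext_walk (append_right_cancel ω₂ h'))
  set S : Set (DomainSAW Ω δ u b) :=
    {γ | ∃ β : (discreteDomainGraph Ω δ).Walk u u', γ.walk = β.append ω₂ ∧ P β.support} with hSdef
  set S' : Set (DomainSAW Ω δ u u') :=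
    {β' | (∀ v ∈ ω₂.support, v ∈ β'.walk.support → v = u') ∧ P β'.walk.support} with hS'def
  have hS : S ⊆ Set.range Φ := by
    rintro γ ⟨β, hβ, -⟩
    have hpath : (β.append ω₂).IsPath := hβ ▸ γ.isPath
    obtain ⟨hβp, -, hcompat⟩ := (isPath_append_iff β ω₂).1 hpath
    exact ⟨⟨⟨β, hβp⟩, hcompat⟩, domainSAW_ext_walk (by rw [hwalk, hβ])⟩
  have hmem : ∀ β' : C, (β' ∈ Φ ⁻¹' S ↔ (β'.1 ∈ S')) := by
    rintro ⟨β', hβ'⟩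
    simp only [Set.mem_preimage, hSdef, hS'def, Set.mem_setOf_eq]
    constructor
    · rintro ⟨β, hβ, hP⟩
      have hβ'' : β'.walk = β := append_right_cancel ω₂ hβ
      exact ⟨hβ', hβ'' ▸ hP⟩
    · rintro ⟨-, hP⟩
      exact ⟨β'.walk, rfl, hP⟩
  have hxc : 0 ≤ criticalFugacity := criticalFugacity_pos_lt_one'.1.le
  have key : ∀ β' : C,
      (Φ ⁻¹' S).indicator (fun i => ENNReal.ofReal (criticalFugacity ^ (Φ i).length)) β' =
        S'.indicator (fun β' => ENNReal.ofReal (criticalFugacity ^ ω₂.length) *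
          ENNReal.ofReal (criticalFugacity ^ β'.length)) β'.1 := by
    intro β'
    by_cases h : β'.1 ∈ S'
    · rw [Set.indicator_of_mem ((hmem β').2 h), Set.indicator_of_mem h, hlen, pow_add,
        ENNReal.ofReal_mul (pow_nonneg hxc _), mul_comm]
    · rw [Set.indicator_of_notMem (fun h' => h ((hmem β').1 h')), Set.indicator_of_notMem h]
  rw [weight_eq_tsum_preimage Φ hΦ hS, tsum_congr key,
    tsum_subtype C (S'.indicator fun β' => ENNReal.ofReal (criticalFugacity ^ ω₂.length) *
      ENNReal.ofReal (criticalFugacity ^ β'.length)),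
    Set.indicator_indicator, Set.inter_eq_right.2 (fun β' hβ' => hβ'.1), weight_eq_tsum_indicator,
    ← ENNReal.tsum_mul_left]
  exact tsum_congr fun β' => Set.indicator_const_mul _ _ _ _

/-! ### Avoiding `K` versus the graph restricted to `Keep(b, K)` -/

/-- **Avoidance = restriction to `Keep`.**  If the graph `Ω'_δ` is `Ω_δ` restricted to
`Keep(b, K) = {v | some walk v → b of Ω_δ avoids K}` and `t ∉ K`, then for every event `P` read on the
vertex sequence `w_{Ω,t,b}(avoid K ∧ P) = w_{Ω',t,b}(P)`: a chord avoiding `K` runs inside `Keep`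
(restriction identity `weight_restrict` with the isolated set `Keepᶜ ⊇ K`, cut lemma); and if `t ∉ Keep`
both sides vanish (no chord at all). [folklore] -/
theorem weight_avoid_eq_of_keep {K : Set (Site 2)}
    (hadj : ∀ x y, (discreteDomainGraph Ω' δ).Adj x y ↔
      ((discreteDomainGraph Ω δ).Adj x y ∧
        (∃ q : (discreteDomainGraph Ω δ).Walk x b, ∀ v ∈ q.support, v ∉ K) ∧
        (∃ q : (discreteDomainGraph Ω δ).Walk y b, ∀ v ∈ q.support, v ∉ K)))
    (ht : t ∉ K) (P : List (Site 2) → Prop) :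
    weight Ω δ t b {γ | (∀ v ∈ γ.walk.support, v ∉ K) ∧ P γ.walk.support} =
      weight Ω' δ t b {γ' | P γ'.walk.support} := by
  classical
  -- the isolated set `Keepᶜ`
  set K' : Set (Site 2) := {v | ¬ ∃ q : (discreteDomainGraph Ω δ).Walk v b, ∀ x ∈ q.support, x ∉ K}
    with hK'
  have hadj' : ∀ x y, (discreteDomainGraph Ω' δ).Adj x y ↔
      ((discreteDomainGraph Ω δ).Adj x y ∧ x ∉ K' ∧ y ∉ K') := by
    intro x y
    rw [hadj x y]
    simp only [hK', Set.mem_setOf_eq, not_not]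
  have hKK' : K ⊆ K' := fun v hv ⟨q, hq⟩ => hq v q.start_mem_support hv
  have hcut : ∀ v ∈ K', v ∉ K → ∀ p : (discreteDomainGraph Ω δ).Walk v b, ∃ x ∈ p.support, x ∈ K := by
    intro v hv _ p
    by_contra h
    push Not at h
    exact hv ⟨p, h⟩
  by_cases htK : t ∈ K'
  · -- no chord from `t` to `b` avoids `K`; on the `Ω'` side `t` is isolated and `t ≠ b`
    have hl : {γ : DomainSAW Ω δ t b | (∀ v ∈ γ.walk.support, v ∉ K) ∧ P γ.walk.support} = ∅ := by
      refine Set.eq_empty_of_forall_notMem fun γ hγ => htK ⟨γ.walk, hγ.1⟩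
    have hr : {γ' : DomainSAW Ω' δ t b | P γ'.walk.support} = ∅ := by
      refine Set.eq_empty_of_forall_notMem fun γ' _ => ?_
      have htb : t ≠ b := by
        rintro rfl
        exact htK ⟨SimpleGraph.Walk.nil, fun x hx => by
          rw [SimpleGraph.Walk.support_nil, List.mem_singleton] at hx
          exact hx ▸ ht⟩
      cases hw : γ'.walk with
      | nil => exact htb rfl
      | cons h _ => exact ((hadj' _ _).1 h).2.1 htK
    rw [hl, hr, measure_empty, measure_empty]
  · rw [weight_restrict hadj' htK P]
    congr 1
    ext γ
    simp only [Set.mem_setOf_eq]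
    rw [forall_support_notMem_iff_of_cut (K := K') (K₀ := K) hKK' hcut γ]

/-! ### (T) The tail given the necklace -/

/-- **Registered helper `necklace_tailIdentity`** (crux stmt-CriticalPhenomena-1878, stub `stub_necklace`;
DEF-FREE): **the TAIL given the NECKLACE is the critical chord of the hung carrier.**  For a self-avoiding
prefix `ω : a → t` of `Ω_δ`, a set `K ∌ t` of sites containing `ω ∖ {t}`, and any `Ω'` whose graph is
`Ω_δ` restricted to `Keep(b, K)`:
`w_{Ω,a,b}(γ = ω · q, q avoids K, P(q)) = x_c^{|ω|} · w_{Ω',t,b}(P)` for every event `P` read on the vertex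
sequence (`weight_prefix`, then `weight_avoid_eq_of_keep`).  In the necklace `K` = slit ∪ necklace minus the
LAST slit vertex `t`, so "`q` avoids `K`" says precisely that `t` is the last visit to the slit. [folklore] -/
theorem necklace_tailIdentity :
    ∀ (Ω Ω' : Set ℂ) (δ : ℝ) (a t b : Site 2) (K : Set (Site 2)) (ω : (discreteDomainGraph Ω δ).Walk a t),
      ω.IsPath → t ∉ K → (∀ v ∈ ω.support, v ≠ t → v ∈ K) →
      (∀ x y, (discreteDomainGraph Ω' δ).Adj x y ↔
        ((discreteDomainGraph Ω δ).Adj x y ∧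
          (∃ q : (discreteDomainGraph Ω δ).Walk x b, ∀ v ∈ q.support, v ∉ K) ∧
          (∃ q : (discreteDomainGraph Ω δ).Walk y b, ∀ v ∈ q.support, v ∉ K))) →
      ∀ P : List (Site 2) → Prop,
        SAW.weight Ω δ a b {γ | ∃ q : (discreteDomainGraph Ω δ).Walk t b,
            γ.walk = ω.append q ∧ (∀ v ∈ q.support, v ∉ K) ∧ P q.support} =
          ENNReal.ofReal (SAW.criticalFugacity ^ ω.length) * SAW.weight Ω' δ t b {γ' | P γ'.walk.support} := by
  intro Ω Ω' δ a t b K ω hω htK hωK hadj P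
  rw [weight_prefix ω hω (fun l => (∀ v ∈ l, v ∉ K) ∧ P l), ← weight_avoid_eq_of_keep hadj htK P]
  congr 2
  ext γ
  simp only [Set.mem_setOf_eq]
  constructor
  · rintro ⟨-, h⟩
    exact h
  · rintro ⟨hK, hP⟩
    exact ⟨fun v hv hvω => by_contra fun hvt => hK v hv (hωK v hvω hvt), hK, hP⟩

/-! ### (B) A bead given everything else -/

/-- **Registered helper `necklace_beadIdentity`** (crux stmt-CriticalPhenomena-1878, stub `stub_necklace`;
DEF-FREE): **a BEAD given EVERYTHING ELSE is the critical chord of its hung carrier.**  For self-avoiding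
`ω₁ : a → u` and `ω₂ : u' → b` of `Ω_δ` meeting at most at `u` (then `u = u'`), a set `K ∌ u, u'` of sites
containing `ω₁ ∖ {u}` and `ω₂ ∖ {u'}`, and any `Ω'` whose graph is `Ω_δ` restricted to `Keep(u', K)`:
`w_{Ω,a,b}(γ = ω₁ · β · ω₂, β avoids K, P(β)) = x_c^{|ω₁| + |ω₂|} · w_{Ω',u,u'}(P)`
(`weight_prefix`, `weight_suffix`, `weight_avoid_eq_of_keep`).  In the necklace `K` = slit ∪ all other
pieces minus the bead's two slit vertices. [folklore] -/
theorem necklace_beadIdentity :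
    ∀ (Ω Ω' : Set ℂ) (δ : ℝ) (a u u' b : Site 2) (K : Set (Site 2))
      (ω₁ : (discreteDomainGraph Ω δ).Walk a u) (ω₂ : (discreteDomainGraph Ω δ).Walk u' b),
      ω₁.IsPath → ω₂.IsPath → (∀ v ∈ ω₂.support, v ∈ ω₁.support → v = u) → u ∉ K → u' ∉ K →
      (∀ v ∈ ω₁.support, v ≠ u → v ∈ K) → (∀ v ∈ ω₂.support, v ≠ u' → v ∈ K) →
      (∀ x y, (discreteDomainGraph Ω' δ).Adj x y ↔
        ((discreteDomainGraph Ω δ).Adj x y ∧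
          (∃ q : (discreteDomainGraph Ω δ).Walk x u', ∀ v ∈ q.support, v ∉ K) ∧
          (∃ q : (discreteDomainGraph Ω δ).Walk y u', ∀ v ∈ q.support, v ∉ K))) →
      ∀ P : List (Site 2) → Prop,
        SAW.weight Ω δ a b {γ | ∃ β : (discreteDomainGraph Ω δ).Walk u u',
            γ.walk = ω₁.append (β.append ω₂) ∧ (∀ v ∈ β.support, v ∉ K) ∧ P β.support} =
          ENNReal.ofReal (SAW.criticalFugacity ^ (ω₁.length + ω₂.length)) *
            SAW.weight Ω' δ u u' {γ' | P γ'.walk.support} := by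
  intro Ω Ω' δ a u u' b K ω₁ ω₂ hω₁ hω₂ hdisj huK hu'K hω₁K hω₂K hadj P
  classical
  have hxc : 0 ≤ criticalFugacity := criticalFugacity_pos_lt_one'.1.le
  -- step 1: peel the prefix `ω₁`
  have h1 := weight_prefix (b := b) ω₁ hω₁
    (fun l => ∃ β : (discreteDomainGraph Ω δ).Walk u u', l = (β.append ω₂).support ∧
      (∀ v ∈ β.support, v ∉ K) ∧ P β.support)
  have hlhs : {γ : DomainSAW Ω δ a b | ∃ β : (discreteDomainGraph Ω δ).Walk u u',
        γ.walk = ω₁.append (β.append ω₂) ∧ (∀ v ∈ β.support, v ∉ K) ∧ P β.support} =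
      {γ | ∃ q : (discreteDomainGraph Ω δ).Walk u b, γ.walk = ω₁.append q ∧
        ∃ β : (discreteDomainGraph Ω δ).Walk u u', q.support = (β.append ω₂).support ∧
          (∀ v ∈ β.support, v ∉ K) ∧ P β.support} := by
    ext γ
    simp only [Set.mem_setOf_eq]
    constructor
    · rintro ⟨β, hγ, hβK, hP⟩
      exact ⟨β.append ω₂, hγ, β, rfl, hβK, hP⟩
    · rintro ⟨q, hγ, β, hq, hβK, hP⟩
      exact ⟨β, by rw [hγ, SimpleGraph.Walk.ext_support hq], hβK, hP⟩
  -- step 2: peel the suffix `ω₂`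
  have h2 := weight_suffix (u := u) ω₂ hω₂ (fun l => (∀ v ∈ l, v ∉ K) ∧ P l)
  have hmid : {γ' : DomainSAW Ω δ u b | (∀ v ∈ γ'.walk.support, v ∈ ω₁.support → v = u) ∧
        ∃ β : (discreteDomainGraph Ω δ).Walk u u', γ'.walk.support = (β.append ω₂).support ∧
          (∀ v ∈ β.support, v ∉ K) ∧ P β.support} =
      {γ' | ∃ β : (discreteDomainGraph Ω δ).Walk u u', γ'.walk = β.append ω₂ ∧
        (∀ v ∈ β.support, v ∉ K) ∧ P β.support} := by
    ext γ'
    simp only [Set.mem_setOf_eq]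
    constructor
    · rintro ⟨-, β, hq, hβK, hP⟩
      exact ⟨β, SimpleGraph.Walk.ext_support hq, hβK, hP⟩
    · rintro ⟨β, hq, hβK, hP⟩
      refine ⟨fun v hv hvω₁ => ?_, β, by rw [hq], hβK, hP⟩
      rw [hq, SimpleGraph.Walk.support_append, List.mem_append] at hv
      rcases hv with hv | hv
      · by_contra hvu
        exact hβK v hv (hω₁K v hvω₁ hvu)
      · exact hdisj v (List.mem_of_mem_tail hv) hvω₁
  -- step 3: avoidance = restriction to `Keep(u', K)`
  have h3 := weight_avoid_eq_of_keep (t := u) hadj huK P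
  have hinner : {β' : DomainSAW Ω δ u u' | (∀ v ∈ ω₂.support, v ∈ β'.walk.support → v = u') ∧
        (∀ v ∈ β'.walk.support, v ∉ K) ∧ P β'.walk.support} =
      {β' | (∀ v ∈ β'.walk.support, v ∉ K) ∧ P β'.walk.support} := by
    ext β'
    simp only [Set.mem_setOf_eq]
    constructor
    · rintro ⟨-, h⟩
      exact h
    · rintro ⟨hK, hP⟩
      exact ⟨fun v hvω₂ hv => by_contra fun hvu' => hK v hv (hω₂K v hvω₂ hvu'), hK, hP⟩
  rw [hlhs, h1, hmid, h2, hinner, h3, ← mul_assoc, ← ENNReal.ofReal_mul (pow_nonneg hxc _), ← pow_add]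

end Summit.CriticalPhenomena.SAWScalingLimit.Theorems.FKGToTraversalBound.GatesByBubbleDoorsByFKG

end
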